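import Summits.BirchSwinnertonDyer.BirchSwinnertonDyer.Theorems.ClassRecordThreeEulerHalvesAtThreeCartanTransportSplitLeftOrder
import HarnessLib

/-!
# Cartan transport, brick X2b — the split hull `E_s = {x ∈ X.O₀ : ψ x diagonal mod q}` is an Eichler order of level `M q²`

Helper file for the crux `EulerHalvesAtThree` of route `ClassRecordThree` (node served: residue crux `EulerHalvesAtThreeResidualUpperBound`,
line `cartan`, item NUM := `CartanOnePlaceDegreeLawAtThree`, skeleton `Lines/lattice` v2, mixed input (P+T)), lane (α′). For a Cartan
datum `X : CartanLevelCurveData D M C`, `q ∈ C`, and a matrix residue map `ψ` mod `q` on the hull `X.O₀ = O₁ ∩ O₂` (`O₁, O₂` maximal,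
`[O₁ : X.O₀] = M`; brick X1 extends `ψ` to `ψ₁` on `O₁` and `ψ₂` on `O₂`):
* §1 indices of the residue conditions in `M₂(𝔽_q)` (`[M₂ : row-entry kernel] = q`, two entries `q²`);
* §2 `exists_splitHull` — **`E_s := O_L(M_{ℓ₀} ⊂ O₁) ∩ O_L(M_{ℓ₁} ⊂ O₂)`** (brick X2a: both maximal) **equals
  `{x ∈ X.O₀ : (ψ x)₁₀ = (ψ x)₀₁ = 0}` and `[O_L(M_{ℓ₀}) : E_s] = M q²`** (`= [P₁ : P₁ ∩ O₁] · [P₁ ∩ O₁ : P₁ ∩ X.O₀] · [P₁ ∩ X.O₀ : E_s]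
  = q · M · q`), i.e. `Brandt.IsEichlerOrder X.B E_s (M * q ^ 2)` — the hull of the split sheet at `q`.
No definition is introduced (`E_s` is produced existentially with its membership description); nothing is proved about NUM, (F2b♮) or
any summit statement. [cite: Voight2021, Lemma 17.4.11, 23.2.3, Def. 23.4.1, 23.4.3] [cite: VignerasLNM800, Ch. II §2 Thm. 2.3]
-/

set_option linter.dupNamespace false
set_option autoImplicit false

open scoped MatrixGroups

namespace Summit.BirchSwinnertonDyer.BirchSwinnertonDyer.Theorems.CartanTransport.Split

open Literature.NumberTheory.Automorphic
open Summit.BirchSwinnertonDyer.BirchSwinnertonDyer.Theorems.CartanTransport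

/-! ## §1 Indices of the residue conditions -/

section Index

/-- PROVED — the kernel of one entry has index `q` in `M₂(ℤ/qℤ)`. -/
theorem index_ker_entry (q : ℕ) (i j : Fin 2) : (Matrix.entryAddMonoidHom (ZMod q) i j).ker.index = q := by
  rw [← AddMonoidHom.comap_bot, AddSubgroup.index_comap_of_surjective _ ?_, AddSubgroup.index_bot, Nat.card_zmod]
  intro c
  exact ⟨Matrix.single i j c, by simp [Matrix.entryAddMonoidHom_apply]⟩

/-- PROVED — the joint kernel of the two off-diagonal entries has index `q²` in `M₂(ℤ/qℤ)`. -/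
theorem index_ker_entry_inf_ker_entry (q : ℕ) :
    ((Matrix.entryAddMonoidHom (ZMod q) (1 : Fin 2) (0 : Fin 2)).ker ⊓
      (Matrix.entryAddMonoidHom (ZMod q) (0 : Fin 2) (1 : Fin 2)).ker).index = q * q := by
  rw [← AddMonoidHom.ker_prod, ← AddMonoidHom.comap_bot, AddSubgroup.index_comap_of_surjective _ ?_, AddSubgroup.index_bot, Nat.card_prod,
    Nat.card_zmod]
  rintro ⟨a, b⟩
  refine ⟨Matrix.single (1 : Fin 2) (0 : Fin 2) a + Matrix.single 0 1 b, ?_⟩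
  simp [Matrix.entryAddMonoidHom_apply]

end Index

/-! ## §2 The split hull -/

section Hull

variable {D M : ℕ} {C : Finset ℕ}

/-- PROVED — **the split hull is Eichler of level `M q²`.** For `X : CartanLevelCurveData D M C`, any prime `q` and a matrix residue
map `ψ` mod `q` on `X.O₀` (for `q ∈ C` one exists: brick H1), the lattice `E_s = {x ∈ X.O₀ : (ψ x)₁₀ = (ψ x)₀₁ = 0}` is `Brandt.IsEichlerOrder X.B E_s (M * q ^ 2)`: it is the
intersection of the maximal orders `O_L(M_{ℓ₀} ⊂ O₁)` and `O_L(M_{ℓ₁} ⊂ O₂)` (`X.O₀ = O₁ ∩ O₂`), of index `q · M · q` in the first.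
[cite: Voight2021, Lemma 17.4.11, 23.2.3, Def. 23.4.1, 23.4.3] -/
theorem exists_splitHull (X : CartanLevelCurveData D M C) {q : ℕ} [Fact q.Prime]
    {ψ : X.B → Matrix (Fin 2) (Fin 2) (ZMod q)} (hψ : IsMatrixResidueMap X.O₀ q ψ) :
    ∃ E : Submodule ℤ X.B, (∀ x, x ∈ E ↔ x ∈ X.O₀ ∧ ψ x 1 0 = 0 ∧ ψ x 0 1 = 0) ∧ Brandt.IsEichlerOrder X.B E (M * q ^ 2) := by
  classical
  have hqP : q.Prime := Fact.out
  have h01 : (0 : Fin 2) ≠ 1 := by decide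
  have h10 : (1 : Fin 2) ≠ 0 := by decide
  obtain ⟨O₁, O₂, hO₁, hO₂, hO₀, hidx⟩ := X.isEichlerOrder
  have hZ₀ : IsZOrder X.O₀ := isZOrder_iff_isOrder.mpr X.isEichlerOrder.isOrder
  have hZ₁ : IsZOrder O₁ := isZOrder_iff_isOrder.mpr hO₁.1
  have hZ₂ : IsZOrder O₂ := isZOrder_iff_isOrder.mpr hO₂.1
  have hle₁ : X.O₀ ≤ O₁ := by rw [hO₀]; exact inf_le_left
  have hle₂ : X.O₀ ≤ O₂ := by rw [hO₀]; exact inf_le_right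
  obtain ⟨ψ₁, hψ₁, hag₁⟩ := exists_residueMap_of_le hψ hZ₀ hZ₁ hle₁
  obtain ⟨ψ₂, hψ₂, hag₂⟩ := exists_residueMap_of_le hψ hZ₀ hZ₂ hle₂
  set P₁ := Brandt.leftOrder (hψ₁.idealOf (ZMod q ∙ (Pi.single 0 (1 : ZMod q) : Fin 2 → ZMod q))) with hP₁def
  set P₂ := Brandt.leftOrder (hψ₂.idealOf (ZMod q ∙ (Pi.single 1 (1 : ZMod q) : Fin 2 → ZMod q))) with hP₂def
  have hP₁ : Brandt.IsMaximalOrder X.B P₁ := isMaximalOrder_leftOrder_idealOf hψ₁ hO₁ _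
  have hP₂ : Brandt.IsMaximalOrder X.B P₂ := isMaximalOrder_leftOrder_idealOf hψ₂ hO₂ _
  -- membership
  have hmem : ∀ x, x ∈ P₁ ⊓ P₂ ↔ x ∈ X.O₀ ∧ ψ x 1 0 = 0 ∧ ψ x 0 1 = 0 := by
    intro x
    constructor
    · rintro ⟨hx₁, hx₂⟩
      have hq₁ := (smul_mem_of_mem_leftOrder hψ₁ hZ₁ _ hx₁).1
      have hq₂ := (smul_mem_of_mem_leftOrder hψ₂ hZ₂ _ hx₂).1
      have hq₀ : ((q : ℕ) : ℤ) • x ∈ X.O₀ := by rw [hO₀]; exact ⟨hq₁, hq₂⟩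
      have hr₁ := (apply_smul_eq_zero_of_mem_leftOrder hψ₁ hZ₁ h01 hx₁).1
      have hr₂ := (apply_smul_eq_zero_of_mem_leftOrder hψ₂ hZ₂ h10 hx₂).1
      have hxO₁ : x ∈ O₁ := by
        refine mem_of_mem_leftOrder_of_apply_eq_zero hψ₁ hZ₁ h01 hx₁ ?_
        rw [hag₁ _ hq₀, ← hag₂ _ hq₀]
        exact hr₂ 1
      have hxO₂ : x ∈ O₂ := by
        refine mem_of_mem_leftOrder_of_apply_eq_zero hψ₂ hZ₂ h10 hx₂ ?_
        rw [hag₂ _ hq₀, ← hag₁ _ hq₀]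
        exact hr₁ 0
      have hxO₀ : x ∈ X.O₀ := by rw [hO₀]; exact ⟨hxO₁, hxO₂⟩
      refine ⟨hxO₀, ?_, ?_⟩
      · rw [← hag₁ x hxO₀]; exact (mem_leftOrder_iff_of_mem hψ₁ hZ₁ h01 hxO₁).mp hx₁
      · rw [← hag₂ x hxO₀]; exact (mem_leftOrder_iff_of_mem hψ₂ hZ₂ h10 hxO₂).mp hx₂
    · rintro ⟨hxO₀, hx10, hx01⟩
      exact ⟨(mem_leftOrder_iff_of_mem hψ₁ hZ₁ h01 (hle₁ hxO₀)).mpr (by rw [hag₁ x hxO₀]; exact hx10),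
        (mem_leftOrder_iff_of_mem hψ₂ hZ₂ h10 (hle₂ hxO₀)).mpr (by rw [hag₂ x hxO₀]; exact hx01)⟩
  refine ⟨P₁ ⊓ P₂, hmem, P₁, P₂, hP₁, hP₂, rfl, ?_⟩
  -- the index `[P₁ : P₁ ⊓ P₂] = q · M · q`
  set K₁ : AddSubgroup (Matrix (Fin 2) (Fin 2) (ZMod q)) := (Matrix.entryAddMonoidHom (ZMod q) (1 : Fin 2) (0 : Fin 2)).ker with hK₁
  set K₂ : AddSubgroup (Matrix (Fin 2) (Fin 2) (ZMod q)) := (Matrix.entryAddMonoidHom (ZMod q) (0 : Fin 2) (1 : Fin 2)).ker with hK₂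
  set A := hψ₁.preim K₁ with hAdef
  set Bq := hψ.preim K₁ with hBdef
  have hEeq : P₁ ⊓ P₂ = hψ.preim (K₁ ⊓ K₂) := by
    ext x
    rw [hmem, IsMatrixResidueMap.mem_preim_iff, AddSubgroup.mem_inf, hK₁, hK₂, AddMonoidHom.mem_ker, AddMonoidHom.mem_ker,
      Matrix.entryAddMonoidHom_apply, Matrix.entryAddMonoidHom_apply]
  have hEB : P₁ ⊓ P₂ ≤ Bq := by
    rw [hEeq]
    exact fun x hx => ⟨hx.1, hx.2.1⟩
  have hBA : Bq ≤ A := fun x hx => ⟨hle₁ hx.1, by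
    have := hx.2
    rw [hK₁, AddMonoidHom.mem_ker, Matrix.entryAddMonoidHom_apply] at this ⊢
    rw [hag₁ x hx.1]; exact this⟩
  have hAP : A ≤ P₁ := fun x hx => (mem_leftOrder_iff_of_mem hψ₁ hZ₁ h01 hx.1).mpr (by
    have := hx.2
    rwa [hK₁, AddMonoidHom.mem_ker, Matrix.entryAddMonoidHom_apply] at this)
  -- (c) `[P₁ : A] = q`
  have hc : A.toAddSubgroup.relIndex P₁.toAddSubgroup = q := relIndex_leftOrder hψ₁ hZ₁ h01
  -- (b) `[A : Bq] = M`
  have hBq : Bq.toAddSubgroup = X.O₀.toAddSubgroup ⊓ A.toAddSubgroup := by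
    ext x
    simp only [Submodule.mem_toAddSubgroup, AddSubgroup.mem_inf]
    constructor
    · intro hx; exact ⟨hx.1, hBA hx⟩
    · rintro ⟨hx₀, hxA⟩
      refine ⟨hx₀, ?_⟩
      have := hxA.2
      rw [hK₁, AddMonoidHom.mem_ker, Matrix.entryAddMonoidHom_apply] at this ⊢
      rw [← hag₁ x hx₀]; exact this
  have hsup : X.O₀.toAddSubgroup ⊔ A.toAddSubgroup = O₁.toAddSubgroup := by
    apply le_antisymm (sup_le (fun x hx => hle₁ hx) (fun x hx => (hψ₁.preim_le K₁) hx))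
    intro y hy
    obtain ⟨y₀, hy₀, hψy₀⟩ := hψ.surj (ψ₁ y)
    have hyA : y - y₀ ∈ A := by
      refine ⟨sub_mem hy (hle₁ hy₀), ?_⟩
      rw [hK₁, AddMonoidHom.mem_ker, Matrix.entryAddMonoidHom_apply, hψ₁.map_sub hy (hle₁ hy₀), hag₁ y₀ hy₀, hψy₀, sub_self,
        Matrix.zero_apply]
    have : y = y₀ + (y - y₀) := by abel
    rw [this]
    exact AddSubgroup.add_mem_sup hy₀ hyA
  have hb : Bq.toAddSubgroup.relIndex A.toAddSubgroup = M := by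
    rw [hBq, AddSubgroup.inf_relIndex_right, ← AddSubgroup.relIndex_sup_left, hsup, hidx]
  -- (a) `[Bq : E] = q`
  have hEO : (P₁ ⊓ P₂).toAddSubgroup.relIndex X.O₀.toAddSubgroup = q * q := by
    rw [hEeq, hψ.relIndex_preim, hK₁, hK₂]
    exact index_ker_entry_inf_ker_entry q
  have hBO : Bq.toAddSubgroup.relIndex X.O₀.toAddSubgroup = q := by
    rw [hBdef, hψ.relIndex_preim, hK₁]
    exact index_ker_entry q 1 0
  have ha : (P₁ ⊓ P₂).toAddSubgroup.relIndex Bq.toAddSubgroup = q := by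
    have := AddSubgroup.relIndex_mul_relIndex (P₁ ⊓ P₂).toAddSubgroup Bq.toAddSubgroup X.O₀.toAddSubgroup
      (fun x hx => hEB hx) (fun x hx => (hψ.preim_le K₁) hx)
    rw [hEO, hBO] at this
    exact Nat.eq_of_mul_eq_mul_right hqP.pos this
  -- assemble
  have h1 := AddSubgroup.relIndex_mul_relIndex (P₁ ⊓ P₂).toAddSubgroup Bq.toAddSubgroup A.toAddSubgroup
    (fun x hx => hEB hx) (fun x hx => hBA hx)
  have h2 := AddSubgroup.relIndex_mul_relIndex (P₁ ⊓ P₂).toAddSubgroup A.toAddSubgroup P₁.toAddSubgroup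
    (fun x hx => hBA (hEB hx)) (fun x hx => hAP hx)
  rw [← h2, ← h1, ha, hb, hc]
  ring

end Hull

end Summit.BirchSwinnertonDyer.BirchSwinnertonDyer.Theorems.CartanTransport.Split
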